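import Literature.NumberTheory.Automorphic.ShimuraCurveUnitGroupTraces
import Literature.NumberTheory.Automorphic.HypFundamentalDomainVolume
import Literature.NumberTheory.Automorphic.BrandtModuleResidue
import Literature.NumberTheory.Automorphic.QuaternionConjugacy
import HarnessLib

/-!
# `X₀^D(M)` has finite hyperbolic area for `D > 1`: the unit group `Γ₀^D(M) = ι(O¹)` of an
# order in an indefinite division quaternion algebra over `ℚ` is a lattice (Minkowski)

Everything here is PROVED (theorems only; no definitions, no named facts). For a Shimura curve
datum `X : ShimuraCurveData D M` (`ShimuraCurve.lean`) with `D > 1`: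

* `ShimuraCurveData.exists_forall_exists_smul_mem_closedBall` — **a compact set of
  representatives**: there is `ρ` such that every point of `ℍ` has a `Γ₀^D(M)`-translate in the
  closed hyperbolic ball `B̄(i, ρ)` (so `Γ₀^D(M)∖ℍ` is compact);
* `ShimuraCurveData.volume_fd_lt_top` — **`vol(X.fd) < ∞`** for the datum's (arbitrary measurable
  a.e.) fundamental domain, by unfolding the indicator of that ball over `X.fd`
  (tree `setLIntegral_tsum_smul_eq`): `vol(X.fd) ≤ 2 vol(B̄(i, ρ))`.

This is Vignéras, LNM 800, Ch. IV Thm. 1.1 ("`φ(O¹)` est un groupe discret de covolume fini,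
cocompact si `H` est un corps") over `ℚ`, and the standing fact "`X^{an}_{U,g}` is a compact …
curve, because `B` is a division algebra" of Pasten (2024), §8.1 p. 29; it is the input that makes
the tree's rendering of Pasten's Thm. 8.1 unconditional (`PastenShimura2024_thm_8_1_of_volume_fd_ne_top`,
`ShimuraCurveNormComparisonProofs.lean`).

## The proof (geometry of numbers; Vignéras IV §1, cf. Katok, *Fuchsian groups*, Thm. 5.4.1)

1. *Division.* For `D > 1` the algebra `B` is ramified somewhere, hence (Wedderburn dichotomy,
   tree `forall_isUnit_or_nonempty_algEquiv_matrix`, and `isSplitAt_of_algEquiv_matrix`) a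
   division algebra (as in the tree's `ShimuraCurveData.isUnit_of_ne_zero`,
   `ShimuraCurveDivisionLattice.lean`; a private copy here).
2. *The real splitting.* `tr ι(x) = trd(x)` and `det ι(x) = nrd(x)` for all `x ∈ B` (comparison of
   Cayley–Hamilton for `ι(x)` with the tree's `x² = trd(x) x − nrd(x)`); the trace form
   `(x, y) ↦ trd(xy)` is non-degenerate (take `y = x⁻¹`: `trd(1) = 2`), so a `ℚ`-basis of `B` is
   mapped by `ι` to an `ℝ`-basis of `M₂(ℝ)` (`linearIndependent_ι_comp`): `ι(O)` is a full lattice.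
3. *Minkowski.* `det(X ↦ g X) = det(g)²` on `M₂(ℝ)` (`det_mulLeft`), so all the lattices
   `g ι(O)`, `g ∈ SL₂(ℝ)`, have the same covolume, and Minkowski's convex body theorem (Mathlib
   `exists_ne_zero_mem_lattice_of_measure_mul_two_pow_lt_measure`) gives a uniform `R` and, for
   every `g`, some `x ∈ O ∖ 0` with all entries of `g ι(x)` at most `R`
   (`exists_forall_exists_mem_O_abs_le`); then `|nrd x| = |det (g ι(x))| ≤ 2R²`.
4. *Finiteness.* The elements of `O` of reduced norm bounded by `B₀` lie in finitely many orbits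
   `O¹ r` (`exists_finite_reps`): the left ideal `O x` contains `nrd(x) O = O x̄ x`
   (`x̄ ∈ O`, tree `IsZOrder.standardInvolution_mem`), hence `B₀! · O`, and there are finitely many
   lattices between `B₀! O` and `O` (tree `finite_setOf_le_and_smul_mem`); `O x = O r` with
   `nrd x, nrd r` of the same sign forces `x = u r` with `u ∈ O^×`, `nrd u = 1`.
5. *Compactness.* Writing `z = h i` (`h ∈ SL₂(ℝ)`) and `x = u r` as above for the vector of
   step 3 with `g = h⁻¹`, the element `γ = ι(u)⁻¹ ∈ Γ₀^D(M)` has `γ h = ι(r) k⁻¹` with `k = h⁻¹ ι(x)`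
   of bounded entries and `|det k| = |nrd x| ≥ 1`; so `γ h` has bounded entries and
   `cosh d(i, γ z) = ‖γ h‖²/2` (`cosh_dist_I_smul`) is bounded.

## References

* M.-F. Vignéras, *Arithmétique des algèbres de quaternions*, LNM 800 (1980), Ch. IV §1
  Thm. 1.1. [VignerasLNM800]
* H. Pasten, *Shimura curves and the abc conjecture*, J. Number Theory 254 (2024) =
  arXiv:1705.09251, §8.1 p. 29. [PastenShimura2024]
-/

noncomputable section

open scoped MatrixGroups ENNReal
open UpperHalfPlane _root_.MeasureTheory Module Set

namespace Literature.NumberTheory.Automorphic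

/-! ### Linear algebra of `M₂(ℝ)` -/

/-- The two columns of a `2 × 2` matrix give a linear equivalence `M₂(ℝ) ≃ ℝ² × ℝ²` conjugating
left multiplication by `g` to `g ⊕ g`. [folklore] -/
theorem exists_columns_linearEquiv :
    ∃ e : Matrix (Fin 2) (Fin 2) ℝ ≃ₗ[ℝ] (Fin 2 → ℝ) × (Fin 2 → ℝ),
      ∀ g : Matrix (Fin 2) (Fin 2) ℝ,
        (e : Matrix (Fin 2) (Fin 2) ℝ →ₗ[ℝ] _) ∘ₗ LinearMap.mulLeft ℝ g ∘ₗ (e.symm : _ →ₗ[ℝ] _) =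
          LinearMap.prodMap (Matrix.toLin' g) (Matrix.toLin' g) := by
  let e : Matrix (Fin 2) (Fin 2) ℝ ≃ₗ[ℝ] (Fin 2 → ℝ) × (Fin 2 → ℝ) :=
    { toFun := fun A => (fun i => A i 0, fun i => A i 1)
      invFun := fun p => Matrix.of fun i j => if j = 0 then p.1 i else p.2 i
      map_add' := fun A B => rfl
      map_smul' := fun c A => rfl
      left_inv := fun A => by
        ext i j
        fin_cases j <;> simp
      right_inv := fun p => by
        ext i <;> simp }
  refine ⟨e, fun g => ?_⟩
  apply LinearMap.ext
  rintro ⟨c₀, c₁⟩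
  ext i <;> fin_cases i <;>
    simp [e, Matrix.mul_apply, Fin.sum_univ_two, Matrix.toLin'_apply]

/-- **`det (X ↦ g X) = (det g)²`** on `M₂(ℝ)`: left multiplication acts as `g` on each of the two
columns. [folklore] -/
theorem det_mulLeft (g : Matrix (Fin 2) (Fin 2) ℝ) :
    LinearMap.det (LinearMap.mulLeft ℝ g : Matrix (Fin 2) (Fin 2) ℝ →ₗ[ℝ] Matrix (Fin 2) (Fin 2) ℝ) =
      g.det ^ 2 := by
  obtain ⟨e, he⟩ := exists_columns_linearEquiv
  rw [← LinearMap.det_conj (LinearMap.mulLeft ℝ g) e, he, LinearMap.det_prodMap, LinearMap.det_toLin',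
    sq]

/-- Cayley–Hamilton for a real `2 × 2` matrix: `G² = tr(G) G − det(G) · 1`. [folklore] -/
theorem mul_self_eq_trace_smul_sub_det_smul (G : Matrix (Fin 2) (Fin 2) ℝ) :
    G * G = G.trace • G - G.det • (1 : Matrix (Fin 2) (Fin 2) ℝ) := by
  ext i j
  rw [Matrix.det_fin_two]
  fin_cases i <;> fin_cases j <;>
    simp [Matrix.mul_apply, Fin.sum_univ_two, Matrix.trace_fin_two] <;> ring

/-- For `w ∈ SL₂(ℝ)`: `cosh d(i, w i) = ‖w‖²/2` (Frobenius norm), the classical formula for the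
displacement of the base point. [folklore] -/
theorem cosh_dist_I_smul (w : GL (Fin 2) ℝ) (hw : (w : Matrix (Fin 2) (Fin 2) ℝ).det = 1) :
    Real.cosh (dist UpperHalfPlane.I (w • UpperHalfPlane.I)) =
      ((w 0 0 : ℝ) ^ 2 + (w 0 1 : ℝ) ^ 2 + (w 1 0 : ℝ) ^ 2 + (w 1 1 : ℝ) ^ 2) / 2 := by
  have hdet1 : ((w.det : ℝˣ) : ℝ) = 1 := by rw [Matrix.GeneralLinearGroup.val_det_apply, hw]
  have hdetpos : 0 < ((w.det : ℝˣ) : ℝ) := by rw [hdet1]; exact one_pos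
  have had : (w 0 0 : ℝ) * w 1 1 - w 0 1 * w 1 0 = 1 := by
    rw [Matrix.det_fin_two] at hw
    exact hw
  rw [UpperHalfPlane.cosh_dist]
  have hcoe : ((w • UpperHalfPlane.I : ℍ) : ℂ) = num w UpperHalfPlane.I / denom w UpperHalfPlane.I :=
    coe_smul_of_det_pos hdetpos _
  have him : (w • UpperHalfPlane.I).im = 1 / Complex.normSq (denom w UpperHalfPlane.I) := by
    rw [im_smul_eq_div_normSq]
    have habs : |((w.det : ℝˣ) : ℝ)| = 1 := by rw [hdet1, abs_one]
    rw [habs, UpperHalfPlane.I_im, one_mul]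
  have hD : denom w UpperHalfPlane.I ≠ 0 := denom_ne_zero w _
  have hDpos : 0 < Complex.normSq (denom w UpperHalfPlane.I) := Complex.normSq_pos.mpr hD
  rw [Complex.dist_eq, him, hcoe, UpperHalfPlane.I_im]
  have e1 : ‖(UpperHalfPlane.I : ℂ) - num w UpperHalfPlane.I / denom w UpperHalfPlane.I‖ ^ 2 =
      Complex.normSq ((UpperHalfPlane.I : ℂ) * denom w UpperHalfPlane.I - num w UpperHalfPlane.I) /
        Complex.normSq (denom w UpperHalfPlane.I) := by
    rw [← Complex.normSq_eq_norm_sq, ← Complex.normSq_div]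
    congr 1
    field_simp
  rw [e1]
  have hnD : Complex.normSq (denom w UpperHalfPlane.I) = (w 1 0 : ℝ) ^ 2 + (w 1 1 : ℝ) ^ 2 := by
    rw [denom, Complex.normSq_apply]
    simp only [Complex.add_re, Complex.mul_re, Complex.ofReal_re, Complex.ofReal_im,
      Complex.add_im, Complex.mul_im, UpperHalfPlane.coe_I, Complex.I_re, Complex.I_im]
    ring
  have hnQ : Complex.normSq ((UpperHalfPlane.I : ℂ) * denom w UpperHalfPlane.I - num w UpperHalfPlane.I) =
      ((w 1 0 : ℝ) + w 0 1) ^ 2 + ((w 1 1 : ℝ) - w 0 0) ^ 2 := by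
    rw [denom, num, Complex.normSq_apply]
    simp only [Complex.sub_re, Complex.mul_re, Complex.add_re, Complex.ofReal_re, Complex.ofReal_im,
      Complex.add_im, Complex.mul_im, Complex.sub_im, UpperHalfPlane.coe_I, Complex.I_re,
      Complex.I_im]
    ring
  have e2 : Complex.normSq ((UpperHalfPlane.I : ℂ) * denom w UpperHalfPlane.I - num w UpperHalfPlane.I) /
      Complex.normSq (denom w UpperHalfPlane.I) / (2 * 1 * (1 / Complex.normSq (denom w UpperHalfPlane.I))) =
      Complex.normSq ((UpperHalfPlane.I : ℂ) * denom w UpperHalfPlane.I - num w UpperHalfPlane.I) / 2 := by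
    field_simp
  rw [e2, hnQ]
  linear_combination (-1 : ℝ) * had

/-- For a real `2 × 2` matrix with entries bounded by `A`: `|det| ≤ 2A²`. [folklore] -/
theorem abs_det_le_of_abs_le {k : Matrix (Fin 2) (Fin 2) ℝ} {A : ℝ} (hk : ∀ i j, |k i j| ≤ A) :
    |k.det| ≤ 2 * A ^ 2 := by
  have hA : 0 ≤ A := (abs_nonneg _).trans (hk 0 0)
  rw [Matrix.det_fin_two]
  have h1 : |k 0 0 * k 1 1| ≤ A * A := by
    rw [abs_mul]; exact mul_le_mul (hk 0 0) (hk 1 1) (abs_nonneg _) hA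
  have h2 : |k 0 1 * k 1 0| ≤ A * A := by
    rw [abs_mul]; exact mul_le_mul (hk 0 1) (hk 1 0) (abs_nonneg _) hA
  calc |k 0 0 * k 1 1 - k 0 1 * k 1 0| ≤ |k 0 0 * k 1 1| + |k 0 1 * k 1 0| := abs_sub _ _
    _ ≤ 2 * A ^ 2 := by nlinarith

/-- For a real `2 × 2` matrix `k` with entries bounded by `A` and `|det k| ≥ 1`, the entries of
`k⁻¹ = (det k)⁻¹ adj(k)` are bounded by `A`. [folklore] -/
theorem abs_inv_apply_le {k : Matrix (Fin 2) (Fin 2) ℝ} {A : ℝ} (hk : ∀ i j, |k i j| ≤ A)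
    (hdet : 1 ≤ |k.det|) (i j : Fin 2) : |k⁻¹ i j| ≤ A := by
  have hA : 0 ≤ A := (abs_nonneg _).trans (hk 0 0)
  have hadj : |k.adjugate i j| ≤ A := by
    rw [Matrix.adjugate_fin_two]
    fin_cases i <;> fin_cases j <;> simp [abs_neg, hk]
  rw [Matrix.inv_def, Matrix.smul_apply, smul_eq_mul, abs_mul, Ring.inverse_eq_inv', abs_inv]
  calc |k.det|⁻¹ * |k.adjugate i j| ≤ 1 * A := by
        apply mul_le_mul (inv_le_one_of_one_le₀ hdet) hadj (abs_nonneg _) zero_le_one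
    _ = A := one_mul A

namespace ShimuraCurveData

variable {D M : ℕ} (X : ShimuraCurveData D M)

/-! ### The quaternion algebra of a datum with `D > 1` is a division algebra -/

/-- For `D > 1`, `B` is a division algebra: a quaternion algebra is a division algebra or
`≅ M₂(ℚ)` (tree `forall_isUnit_or_nonempty_algEquiv_matrix`), and `M₂(ℚ)` is split at every
finite place whereas `B` is ramified at the primes of `D`. A local copy (different proof) of the
tree's public `ShimuraCurveData.isUnit_of_ne_zero` (`ShimuraCurveDivisionLattice.lean`), kept
private so that this file does not depend on that module. [cite: VignerasLNM800, Ch. III §3] -/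
private theorem isUnit_of_one_lt (hD : 1 < D) {x : X.B} (hx : x ≠ 0) : IsUnit x := by
  rcases forall_isUnit_or_nonempty_algEquiv_matrix ℚ X.B with h | h
  · exact h x hx
  · exfalso
    obtain ⟨e⟩ := h
    obtain ⟨p, hp, hpD⟩ := Nat.exists_prime_and_dvd hD.ne'
    let v : IsDedekindDomain.HeightOneSpectrum (NumberField.RingOfIntegers ℚ) :=
      Rat.HeightOneSpectrum.primesEquiv.symm ⟨p, hp⟩
    have hv : v ∈ ramifiedPlaces ℚ X.B := by
      rw [X.ramifiedPlaces_eq]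
      show ((Rat.HeightOneSpectrum.primesEquiv v : Nat.Primes) : ℕ) ∣ D
      simp [v, hpD]
    exact hv (isSplitAt_of_algEquiv_matrix e v)

/-- No zero divisors for `D > 1`. [folklore] -/
theorem eq_zero_or_eq_zero_of_mul_eq_zero (hD : 1 < D) {x y : X.B} (h : x * y = 0) :
    x = 0 ∨ y = 0 := by
  by_cases hx : x = 0
  · exact Or.inl hx
  · right
    obtain ⟨u, rfl⟩ := X.isUnit_of_one_lt hD hx
    simpa using congrArg (fun z => (↑u⁻¹ : X.B) * z) h

/-- The Eichler order of a datum is a `ℤ`-order (`IsZOrder`, the notion of the tree's Brandt-module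
files; same data as `Brandt.IsOrder`). [folklore] -/
theorem isZOrder : IsZOrder X.O := ⟨X.isOrder.one_mem, X.isOrder.mul_mem, X.isOrder.isFullLattice⟩

/-- A `ℤ`-basis of `O` indexed by `Fin 4` which is a `ℚ`-basis of `B` (a full `ℤ`-lattice
presents `B` as `ℤ⁰⁻¹ O`, tree `isLocalizedModule_subtype_of_isFullLattice`). [folklore] -/
theorem exists_basis :
    ∃ (b : Basis (Fin 4) ℤ X.O) (bQ : Basis (Fin 4) ℚ X.B), ∀ i, bQ i = (b i : X.B) := by
  obtain ⟨b⟩ := X.isZOrder.exists_basis_fin_four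
  haveI := isLocalizedModule_subtype_of_isFullLattice X.isOrder.isFullLattice
  exact ⟨b, b.ofIsLocalizedModule ℚ (nonZeroDivisors ℤ) X.O.subtype, fun i =>
    b.ofIsLocalizedModule_apply ℚ (nonZeroDivisors ℤ) X.O.subtype i⟩

/-! ### The real splitting: `tr ι = trd`, `det ι = nrd`, and `ι(B)` spans `M₂(ℝ)` -/

/-- A scalar matrix in the image of `ι` comes from a scalar of `B` (the centre of `B` is `ℚ`).
[folklore] -/
theorem eq_algebraMap_of_ι_eq_smul_one {x : X.B} {s : ℝ}
    (hs : X.ι x = s • (1 : Matrix (Fin 2) (Fin 2) ℝ)) :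
    ∃ q : ℚ, x = algebraMap ℚ X.B q ∧ (q : ℝ) = s := by
  have hcen : x ∈ Subalgebra.center ℚ X.B := by
    rw [Subalgebra.mem_center_iff]
    intro b
    apply X.ι_injective
    rw [map_mul, map_mul, hs, smul_mul_assoc, mul_smul_comm, one_mul, mul_one]
  rw [Algebra.IsCentral.center_eq_bot ℚ X.B, Algebra.mem_bot] at hcen
  obtain ⟨q, rfl⟩ := hcen
  refine ⟨q, rfl, ?_⟩
  have h := congrFun (congrFun hs 0) 0
  rw [AlgHom.commutes, Matrix.algebraMap_matrix_apply] at h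
  simpa using h

/-- **`tr ι(x) = trd(x)` and `det ι(x) = nrd(x)`**: Cayley–Hamilton `ι(x)² = tr ι(x) − det` against
the tree's `x² = trd(x) x − nrd(x)` (`mul_self_eq_reducedTrace_mul_sub_reducedNorm`); for scalar
`ι(x)`, `x ∈ ℚ` and both sides are `2q`, `q²`. [folklore] -/
theorem trace_ι_eq_and_det_ι_eq (x : X.B) :
    (X.ι x).trace = (reducedTrace ℚ X.B x : ℝ) ∧ (X.ι x).det = (reducedNorm ℚ X.B x : ℝ) := by
  set G := X.ι x with hG
  have hq := mul_self_eq_reducedTrace_mul_sub_reducedNorm ℚ X.B x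
  have h1 : G * G = (reducedTrace ℚ X.B x : ℝ) • G - (reducedNorm ℚ X.B x : ℝ) • 1 := by
    have := congrArg X.ι hq
    rw [map_mul, map_sub, map_mul, AlgHom.commutes, AlgHom.commutes, Algebra.algebraMap_eq_smul_one,
      Algebra.algebraMap_eq_smul_one, smul_mul_assoc, one_mul] at this
    rw [this, ← algebraMap_smul ℝ (reducedTrace ℚ X.B x), ← algebraMap_smul ℝ (reducedNorm ℚ X.B x),
      eq_ratCast, eq_ratCast]
  have h2 := mul_self_eq_trace_smul_sub_det_smul G
  have h3 : (G.trace - reducedTrace ℚ X.B x) • G =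
      (G.det - (reducedNorm ℚ X.B x : ℝ)) • (1 : Matrix (Fin 2) (Fin 2) ℝ) := by
    have h12 := h1.symm.trans h2
    rw [sub_smul, sub_smul]
    calc G.trace • G - (reducedTrace ℚ X.B x : ℝ) • G
        = (G.trace • G - G.det • (1 : Matrix (Fin 2) (Fin 2) ℝ)) -
            ((reducedTrace ℚ X.B x : ℝ) • G - (reducedNorm ℚ X.B x : ℝ) • 1) +
          (G.det • (1 : Matrix (Fin 2) (Fin 2) ℝ) - (reducedNorm ℚ X.B x : ℝ) • 1) := by abel
      _ = _ := by rw [h12, sub_self, zero_add]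
  by_cases hsc : G 0 1 = 0 ∧ G 1 0 = 0 ∧ G 0 0 = G 1 1
  · -- scalar: `x = q`
    obtain ⟨h01, h10, h00⟩ := hsc
    have hGs : G = (G 0 0) • (1 : Matrix (Fin 2) (Fin 2) ℝ) := by
      ext i j
      fin_cases i <;> fin_cases j <;> simp [h01, h10, h00]
    obtain ⟨q, rfl, hqs⟩ := X.eq_algebraMap_of_ι_eq_smul_one hGs
    have htrd : reducedTrace ℚ X.B (algebraMap ℚ X.B q) = 2 * q := by
      simp only [reducedTrace, LinearMap.smul_apply, leftMulTrace_algebraMap,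
        IsQuaternionAlgebra.finrank_eq_four (K := ℚ) (D := X.B), smul_eq_mul]
      push_cast
      ring
    have hnrd : reducedNorm ℚ X.B (algebraMap ℚ X.B q) = q ^ 2 := by
      have h := mul_self_eq_reducedTrace_mul_sub_reducedNorm ℚ X.B (algebraMap ℚ X.B q)
      rw [htrd, ← map_mul, ← map_mul, ← map_sub] at h
      haveI : Nontrivial X.B := Module.nontrivial_of_finrank_pos (R := ℚ)
        (by rw [IsQuaternionAlgebra.finrank_eq_four (K := ℚ) (D := X.B)]; norm_num)
      have := (algebraMap ℚ X.B).injective h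
      linear_combination this
    rw [htrd, hnrd]
    constructor
    · rw [hGs, Matrix.trace_smul, Matrix.trace_one, ← hqs]; push_cast; simp; ring
    · rw [hGs, Matrix.det_smul, Matrix.det_one, ← hqs]; push_cast; simp
  · -- non-scalar: compare coefficients
    set α : ℝ := G.det - (reducedNorm ℚ X.B x : ℝ) with hα
    set β : ℝ := G.trace - reducedTrace ℚ X.B x with hβ
    have e00 := congrFun (congrFun h3 0) 0
    have e01 := congrFun (congrFun h3 0) 1
    have e10 := congrFun (congrFun h3 1) 0
    have e11 := congrFun (congrFun h3 1) 1
    simp only [Matrix.smul_apply, Matrix.one_apply_eq, Matrix.one_apply_ne, ne_eq, zero_ne_one,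
      one_ne_zero, not_false_eq_true, smul_eq_mul, mul_one, mul_zero] at e00 e01 e10 e11
    have hβ0 : β = 0 := by
      by_contra hb
      apply hsc
      refine ⟨(mul_eq_zero.mp e01).resolve_left hb, (mul_eq_zero.mp e10).resolve_left hb, ?_⟩
      have : β * (G 0 0 - G 1 1) = 0 := by linear_combination e00 - e11
      exact sub_eq_zero.mp ((mul_eq_zero.mp this).resolve_left hb)
    have hα0 : α = 0 := by rw [hβ0, zero_mul] at e00; exact e00.symm
    exact ⟨sub_eq_zero.mp hβ0, sub_eq_zero.mp hα0⟩

/-- `trd(1) = 2`. [folklore] -/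
theorem reducedTrace_one : reducedTrace ℚ X.B (1 : X.B) = 2 := by
  have := (X.trace_ι_eq_and_det_ι_eq 1).1
  rw [map_one, Matrix.trace_one, Fintype.card_fin] at this
  exact_mod_cast this.symm

/-- **The real splitting is non-degenerate** (`D > 1`): `ι` maps a `ℚ`-basis of `B` to an
`ℝ`-linearly independent family of `M₂(ℝ)`. The Gram matrix `T = (trd(vᵢ vⱼ))` of the trace form is
rational and non-singular (if `trd(b y) = 0` for all `b` then `y = 0`, else `b = y⁻¹` gives
`trd 1 = 2`); a real relation `Σ rᵢ ι(vᵢ) = 0` gives `r T = 0`. [folklore] -/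
theorem linearIndependent_ι_comp (hD : 1 < D) (v : Basis (Fin 4) ℚ X.B) :
    LinearIndependent ℝ (X.ι ∘ v) := by
  let T : Matrix (Fin 4) (Fin 4) ℚ := Matrix.of fun i j => reducedTrace ℚ X.B (v i * v j)
  have hT : ∀ i j, ((T i j : ℚ) : ℝ) = (X.ι (v i) * X.ι (v j)).trace := by
    intro i j
    rw [← map_mul, (X.trace_ι_eq_and_det_ι_eq _).1]
    rfl
  have hTdet : T.det ≠ 0 := by
    intro hdet
    obtain ⟨c, hc0, hc⟩ := Matrix.exists_mulVec_eq_zero_iff.mpr hdet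
    let y : X.B := ∑ j, c j • v j
    have hy : ∀ b : X.B, reducedTrace ℚ X.B (b * y) = 0 := by
      have hvi : ∀ i, reducedTrace ℚ X.B (v i * y) = 0 := by
        intro i
        have := congrFun hc i
        simp only [Matrix.mulVec, dotProduct, Pi.zero_apply, T, Matrix.of_apply] at this
        rw [← this]
        simp only [y, Finset.mul_sum, map_sum, mul_smul_comm, map_smul, smul_eq_mul, mul_comm (c _)]
      intro b
      obtain ⟨d, rfl⟩ : ∃ d : Fin 4 → ℚ, b = ∑ i, d i • v i := ⟨v.repr b, (v.sum_repr b).symm⟩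
      simp only [Finset.sum_mul, map_sum, smul_mul_assoc, map_smul, hvi, smul_zero,
        Finset.sum_const_zero]
    have hy0 : y = 0 := by
      by_contra hne
      obtain ⟨u, hu⟩ := X.isUnit_of_one_lt hD hne
      have := hy (↑u⁻¹ : X.B)
      rw [← hu, Units.inv_mul, X.reducedTrace_one] at this
      norm_num at this
    apply hc0
    have hli := v.linearIndependent
    rw [Fintype.linearIndependent_iff] at hli
    funext j
    exact hli c hy0 j
  rw [Fintype.linearIndependent_iff]
  intro r hr i
  have hTr : Matrix.vecMul r (T.map (fun q : ℚ => (q : ℝ))) = 0 := by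
    funext j
    simp only [Matrix.vecMul, dotProduct, Matrix.map_apply, Pi.zero_apply, hT]
    have := congrArg (fun m => (m * X.ι (v j)).trace) hr
    simpa [Finset.sum_mul, smul_mul_assoc, Matrix.trace_sum, Matrix.trace_smul] using this
  have hdetR : (T.map (fun q : ℚ => (q : ℝ))).det ≠ 0 := by
    have : (T.map (fun q : ℚ => (q : ℝ))).det = ((T.det : ℚ) : ℝ) := by
      rw [show (fun q : ℚ => (q : ℝ)) = (Rat.castHom ℝ : ℚ → ℝ) from rfl, ← RingHom.mapMatrix_apply,
        ← RingHom.map_det]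
      rfl
    rw [this]
    exact_mod_cast hTdet
  exact congrFun (Matrix.eq_zero_of_vecMul_eq_zero hdetR hTr) i

/-! ### Minkowski: short vectors in the unimodular translates of `ι(O)` -/

/-- **Minkowski's theorem for the lattices `g ι(O)`, `det g = 1`.** There is `R ≥ 1` such that
for every `g ∈ SL₂(ℝ)` some non-zero `x ∈ O` has all entries of `g ι(x)` bounded by `R`:
`ι(O)` is a full lattice of `M₂(ℝ) = ℝ⁴` (`linearIndependent_ι_comp`), the lattices `g ι(O)` all
have the covolume of `ι(O)` (`det_mulLeft`), and the cube `[-R, R]⁴` of volume `(2R)⁴ > 2⁴ covol`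
contains a non-zero lattice point (Mathlib `exists_ne_zero_mem_lattice_of_measure_mul_two_pow_lt_measure`).
[cite: VignerasLNM800, Ch. IV §1 Thm. 1.1 (proof)] -/
theorem exists_forall_exists_mem_O_abs_le (hD : 1 < D) :
    ∃ R : ℝ, 1 ≤ R ∧ ∀ g : Matrix (Fin 2) (Fin 2) ℝ, g.det = 1 →
      ∃ x ∈ X.O, x ≠ 0 ∧ ∀ i j, |(g * X.ι x) i j| ≤ R := by
  obtain ⟨b, bQ, hbQ⟩ := X.exists_basis
  -- `V = ℝ^{2×2}` is `Matrix (Fin 2) (Fin 2) ℝ` by definition; left multiplications as maps of `V`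
  let fV : Matrix (Fin 2) (Fin 2) ℝ → (Fin 2 → Fin 2 → ℝ) →ₗ[ℝ] (Fin 2 → Fin 2 → ℝ) := fun g =>
    (LinearMap.mulLeft ℝ g : Matrix (Fin 2) (Fin 2) ℝ →ₗ[ℝ] Matrix (Fin 2) (Fin 2) ℝ)
  have hfV : ∀ g (A : Matrix (Fin 2) (Fin 2) ℝ), fV g A = g * A := fun g A => rfl
  have hdetfV : ∀ g, LinearMap.det (fV g) = g.det ^ 2 := fun g => det_mulLeft g
  -- the real basis `E_g = (g ι(b i))_i` of `V`
  let E : Matrix (Fin 2) (Fin 2) ℝ → Fin 4 → (Fin 2 → Fin 2 → ℝ) := fun g i =>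
    (g * X.ι (bQ i) : Matrix (Fin 2) (Fin 2) ℝ)
  have hE1 : E 1 = X.ι ∘ bQ := by
    funext i
    simp only [E, one_mul, Function.comp_apply]
  have hEind : ∀ g, g.det ≠ 0 → LinearIndependent ℝ (E g) := by
    intro g hg
    have h1 : LinearIndependent ℝ (E 1) := by rw [hE1]; exact X.linearIndependent_ι_comp hD bQ
    have hker : LinearMap.ker (fV g) = ⊥ := by
      apply LinearMap.ker_eq_bot_of_injective
      intro A B hAB
      have hu : IsUnit g := (Matrix.isUnit_iff_isUnit_det g).mpr (isUnit_iff_ne_zero.mpr hg)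
      exact hu.mul_left_cancel hAB
    have h2 := h1.map' (fV g) hker
    have hEg : E g = fV g ∘ E 1 := by
      funext i
      simp only [E, Function.comp_apply, hfV, one_mul]
    rw [hEg]
    exact h2
  have hcard : Fintype.card (Fin 4) = Module.finrank ℝ (Fin 2 → Fin 2 → ℝ) := by
    simp [Module.finrank_pi_fintype]
  let β : ∀ g : Matrix (Fin 2) (Fin 2) ℝ, g.det ≠ 0 → Basis (Fin 4) ℝ (Fin 2 → Fin 2 → ℝ) :=
    fun g hg => basisOfLinearIndependentOfCardEqFinrank (hEind g hg) hcard
  have hβ : ∀ g hg, ⇑(β g hg) = E g := fun g hg => coe_basisOfLinearIndependentOfCardEqFinrank _ _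
  -- all the fundamental domains have the same volume
  have h10 : (1 : Matrix (Fin 2) (Fin 2) ℝ).det ≠ 0 := by rw [Matrix.det_one]; exact one_ne_zero
  let β₁ := β 1 h10
  have hvol : ∀ g (hg0 : g.det ≠ 0), g.det = 1 →
      volume (ZSpan.fundamentalDomain (β g hg0)) = volume (ZSpan.fundamentalDomain β₁) := by
    intro g hg0 hg
    classical
    rw [ZSpan.measure_fundamentalDomain _ volume β₁]
    have hcomp : ⇑(β g hg0) = fV g ∘ β₁ := by
      rw [hβ g hg0, show ⇑β₁ = E 1 from hβ 1 h10]
      funext i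
      simp only [E, Function.comp_apply, hfV, one_mul]
    rw [hcomp, β₁.det_comp, β₁.det_self, mul_one, hdetfV, hg, one_pow, abs_one, ENNReal.ofReal_one,
      one_mul]
  -- the constant
  have hfin : volume (ZSpan.fundamentalDomain β₁) < ⊤ :=
    (ZSpan.fundamentalDomain_isBounded β₁).measure_lt_top
  set c : ℝ := (volume (ZSpan.fundamentalDomain β₁)).toReal with hc
  have hc0 : 0 ≤ c := ENNReal.toReal_nonneg
  refine ⟨c + 1, by linarith, ?_⟩
  intro g hg
  have hg0 : g.det ≠ 0 := by rw [hg]; exact one_ne_zero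
  -- Minkowski
  let L : AddSubgroup (Fin 2 → Fin 2 → ℝ) := (Submodule.span ℤ (Set.range (β g hg0))).toAddSubgroup
  haveI : Countable L := inferInstanceAs (Countable (Submodule.span ℤ (Set.range (β g hg0))))
  have hR0 : 0 ≤ c + 1 := by linarith
  have hlt : volume (ZSpan.fundamentalDomain (β g hg0)) * 2 ^ Module.finrank ℝ (Fin 2 → Fin 2 → ℝ) <
      volume (Metric.closedBall (0 : Fin 2 → Fin 2 → ℝ) (c + 1)) := by
    rw [hvol g hg0 hg, volume_pi_closedBall _ hR0]
    simp only [Pi.zero_apply, Real.volume_pi_closedBall _ hR0, Fintype.card_fin, Finset.prod_const,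
      Finset.card_univ]
    rw [← hcard, Fintype.card_fin, ← ENNReal.ofReal_toReal hfin.ne, ← hc,
      ← ENNReal.ofReal_pow (by positivity),
      show (2 : ℝ≥0∞) ^ 4 = ENNReal.ofReal (2 ^ 4) by
        rw [ENNReal.ofReal_pow zero_le_two, ENNReal.ofReal_ofNat],
      ← ENNReal.ofReal_mul hc0, ENNReal.ofReal_lt_ofReal_iff (by positivity)]
    have h1 : 1 ≤ c + 1 := by linarith
    have h3 : (1 : ℝ) ≤ (c + 1) ^ 3 := one_le_pow₀ h1
    nlinarith
  obtain ⟨⟨v, hvL⟩, hv0, hvs⟩ := exists_ne_zero_mem_lattice_of_measure_mul_two_pow_lt_measure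
    (ZSpan.isAddFundamentalDomain' (β g hg0) volume)
    (fun x hx => by simpa using hx) (convex_closedBall _ _) hlt
  -- `v = g ι(x)` with `x ∈ O`
  have hvL' : v ∈ Submodule.span ℤ (Set.range (E g)) := by rw [← hβ g hg0]; exact hvL
  let Φ : X.B →ₗ[ℤ] (Fin 2 → Fin 2 → ℝ) :=
    (((fV g).restrictScalars ℚ) ∘ₗ X.ι.toLinearMap).restrictScalars ℤ
  have hΦ : ∀ x, Φ x = (g * X.ι x : Matrix (Fin 2) (Fin 2) ℝ) := fun x => rfl
  have hspan : Submodule.span ℤ (Set.range (E g)) = X.O.map Φ := by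
    have hO : Submodule.span ℤ (Set.range fun i => ((b i : X.O) : X.B)) = X.O := by
      have := congrArg (Submodule.map X.O.subtype) b.span_eq
      rw [Submodule.map_span, Submodule.map_top, Submodule.range_subtype, ← Set.range_comp] at this
      exact this
    have hfun : E g = Φ ∘ fun i => ((b i : X.O) : X.B) := by
      funext i
      simp only [Function.comp_apply, E, hbQ]
      rfl
    rw [← hO, Submodule.map_span, ← Set.range_comp, ← hfun]
  rw [hspan, Submodule.mem_map] at hvL'
  obtain ⟨x, hxO, hxv⟩ := hvL'
  refine ⟨x, hxO, ?_, fun i j => ?_⟩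
  · rintro rfl
    apply hv0
    apply Subtype.ext
    change v = 0
    rw [← hxv, map_zero]
  · have h1 : ‖v‖ ≤ c + 1 := by simpa using hvs
    have h2 : ‖v i j‖ ≤ ‖v‖ := (norm_le_pi_norm (v i) j).trans (norm_le_pi_norm v i)
    rw [Real.norm_eq_abs] at h2
    have : (g * X.ι x) i j = v i j := by rw [← hxv, hΦ]
    rw [this]
    exact h2.trans h1

/-! ### Finitely many elements of bounded reduced norm up to units of norm one -/

/-- **Elements of `O` of bounded reduced norm, up to left units of norm `1`** (`D > 1`): there is a
finite set `T ⊆ O ∖ 0` such that every non-zero `x ∈ O` with `|nrd x| ≤ B₀` is `u r` with `r ∈ T`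
and `u ∈ O^×`, `nrd u = 1`. The left ideal `O x` contains `B₀! · O` (as `nrd(x) y = (y x̄) x` and
`x̄ ∈ O`), there are finitely many lattices between `B₀! O` and `O` (tree
`finite_setOf_le_and_smul_mem`), and `O x = O r` with `nrd x`, `nrd r` of the same sign gives
`x = u r`, `r = v x`, `u v = v u = 1`, `nrd u = 1`. [cite: VignerasLNM800, Ch. IV §1 Thm. 1.1 (proof)] -/
theorem exists_finite_reps (hD : 1 < D) (B₀ : ℕ) :
    ∃ T : Set X.B, T.Finite ∧ (∀ r ∈ T, r ∈ X.O ∧ r ≠ 0) ∧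
      ∀ x ∈ X.O, x ≠ 0 → (nrdZ x).natAbs ≤ B₀ →
        ∃ r ∈ T, ∃ u ∈ X.O, ∃ u' ∈ X.O, u * u' = 1 ∧ u' * u = 1 ∧ nrdZ u = 1 ∧ x = u * r := by
  classical
  have hZ := X.isZOrder
  haveI : IsAddTorsionFree X.B := isAddTorsionFree_of_charZero_module ℚ X.B
  -- the left ideals `O x`
  let Pid : X.B → Submodule ℤ X.B := fun x => X.O.map ((LinearMap.mulRight ℚ x).restrictScalars ℤ)
  have hPmem : ∀ x y, y ∈ Pid x ↔ ∃ o ∈ X.O, o * x = y := fun x y => by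
    simp only [Pid, Submodule.mem_map, LinearMap.restrictScalars_apply, LinearMap.mulRight_apply]
  have hnrd0 : ∀ x ∈ X.O, x ≠ 0 → nrdZ x ≠ 0 := by
    intro x hx hx0 h
    have h1 : reducedNorm ℚ X.B x = 0 := by rw [← hZ.cast_nrdZ hx, h, Int.cast_zero]
    exact ((isUnit_iff_reducedNorm_ne_zero_holds ℚ X.B x).mp (X.isUnit_of_one_lt hD hx0)) h1
  -- the window
  let n₀ : ℤ := (B₀.factorial : ℕ)
  have hn₀ : n₀ ≠ 0 := Int.natCast_ne_zero.mpr (Nat.factorial_ne_zero B₀)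
  let S : Set X.B := {x | x ∈ X.O ∧ x ≠ 0 ∧ (nrdZ x).natAbs ≤ B₀}
  have hwindow : ∀ x ∈ S, Pid x ≤ X.O ∧ ∀ y ∈ X.O, n₀ • y ∈ Pid x := by
    rintro x ⟨hx, hx0, hxB⟩
    refine ⟨?_, fun y hy => ?_⟩
    · rintro _ ⟨o, ho, rfl⟩
      exact X.isOrder.mul_mem _ ho _ hx
    · have hN := hnrd0 x hx hx0
      have hdvd : nrdZ x ∣ n₀ := by
        rw [← Int.natAbs_dvd_natAbs, Int.natAbs_natCast]
        exact Nat.dvd_factorial (Int.natAbs_pos.mpr hN) hxB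
      obtain ⟨m, hm⟩ := hdvd
      rw [hPmem]
      refine ⟨(m : ℤ) • (y * standardInvolution ℚ X.B x), X.O.smul_mem _
        (X.isOrder.mul_mem _ hy _ (hZ.standardInvolution_mem hx)), ?_⟩
      rw [smul_mul_assoc, mul_assoc, hZ.standardInvolution_mul_eq hx, mul_smul_comm, mul_one, smul_smul,
        mul_comm m, ← hm]
  have hfinW := finite_setOf_le_and_smul_mem X.O X.isOrder.isFullLattice.1 hn₀
  -- key each element by its left ideal and the sign of its norm
  let f : X.B → Submodule ℤ X.B × Bool := fun x => (Pid x, decide (0 < nrdZ x))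
  have hfS : (f '' S).Finite := by
    refine (hfinW.prod (Set.finite_univ (α := Bool))).subset ?_
    rintro _ ⟨x, hx, rfl⟩
    exact ⟨hwindow x hx, Set.mem_univ _⟩
  -- representatives
  haveI : Finite (f '' S) := hfS.to_subtype
  let g : f '' S → X.B := fun p => p.2.choose
  have hg : ∀ p : f '' S, g p ∈ S ∧ f (g p) = p := fun p => p.2.choose_spec
  refine ⟨Set.range g, Set.finite_range g, ?_, ?_⟩
  · rintro _ ⟨p, rfl⟩
    exact ⟨(hg p).1.1, (hg p).1.2.1⟩
  · intro x hx hx0 hxB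
    have hxS : x ∈ S := ⟨hx, hx0, hxB⟩
    let p : f '' S := ⟨f x, x, hxS, rfl⟩
    obtain ⟨⟨hr, hr0, -⟩, hfr⟩ := hg p
    set r := g p with hrdef
    have hfr' : f r = f x := hfr
    simp only [f, Prod.mk.injEq] at hfr'
    obtain ⟨hP, hsign⟩ := hfr'
    -- `x ∈ O r` and `r ∈ O x`
    have hxP : x ∈ Pid r := by rw [hP, hPmem]; exact ⟨1, X.isOrder.one_mem, one_mul x⟩
    have hrP : r ∈ Pid x := by rw [← hP, hPmem]; exact ⟨1, X.isOrder.one_mem, one_mul r⟩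
    rw [hPmem] at hxP hrP
    obtain ⟨u, hu, hux⟩ := hxP
    obtain ⟨v, hv, hvr⟩ := hrP
    -- `u v = 1 = v u`
    have huv : u * v = 1 := by
      have h1 : (u * v - 1) * x = 0 := by rw [sub_mul, mul_assoc, hvr, hux, one_mul, sub_self]
      rcases X.eq_zero_or_eq_zero_of_mul_eq_zero hD h1 with h | h
      · exact sub_eq_zero.mp h
      · exact absurd h hx0
    have hvu : v * u = 1 := by
      have h1 : (v * u - 1) * r = 0 := by rw [sub_mul, mul_assoc, hux, hvr, one_mul, sub_self]
      rcases X.eq_zero_or_eq_zero_of_mul_eq_zero hD h1 with h | h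
      · exact sub_eq_zero.mp h
      · exact absurd h hr0
    -- `nrd u = 1`
    have hNuv : nrdZ u * nrdZ v = 1 := by
      rw [← hZ.nrdZ_mul hu hv, huv, IsZOrder.nrdZ_one]
    have hNx : nrdZ x = nrdZ u * nrdZ r := by rw [← hux, hZ.nrdZ_mul hu hr]
    have hNu : nrdZ u = 1 := by
      rcases Int.eq_one_or_neg_one_of_mul_eq_one hNuv with h | h
      · exact h
      · exfalso
        rw [h, neg_one_mul] at hNx
        have hr0' := hnrd0 r hr hr0
        have : decide (0 < nrdZ r) = decide (0 < nrdZ x) := hsign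
        rw [hNx] at this
        simp only [Left.neg_pos_iff, decide_eq_decide] at this
        rcases lt_trichotomy (nrdZ r) 0 with hlt | heq | hgt
        · exact absurd (this.mpr hlt) (not_lt.mpr hlt.le)
        · exact hr0' heq
        · exact absurd (this.mp hgt) (not_lt.mpr hgt.le)
    exact ⟨r, ⟨p, rfl⟩, u, hu, v, hv, huv, hvu, hNu, hux.symm⟩

/-! ### A compact set of representatives and the finiteness of the volume -/

/-- **`Γ₀^D(M)∖ℍ` is covered by a compact ball** (`D > 1`): there is `ρ` such that every `z ∈ ℍ`
has a translate `γ z`, `γ ∈ Γ₀^D(M)`, with `d(i, γ z) ≤ ρ` (Vignéras IV Thm. 1.1: `ι(O¹)` is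
cocompact when `B` is a division algebra). Steps 3–5 of the module docstring.
[cite: VignerasLNM800, Ch. IV §1 Thm. 1.1] -/
theorem exists_forall_exists_smul_mem_closedBall (hD : 1 < D) :
    ∃ ρ : ℝ, ∀ z : ℍ, ∃ γ ∈ X.Gamma, γ • z ∈ Metric.closedBall UpperHalfPlane.I ρ := by
  have hZ := X.isZOrder
  obtain ⟨R, hR1, hR⟩ := X.exists_forall_exists_mem_O_abs_le hD
  obtain ⟨T, hTfin, hTO, hT⟩ := X.exists_finite_reps hD ⌊2 * R ^ 2⌋₊
  -- a uniform bound for the entries of `ι(r)`, `r ∈ T`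
  obtain ⟨A, hA1, hA⟩ : ∃ A : ℝ, 1 ≤ A ∧ ∀ r ∈ T, ∀ i j, |X.ι r i j| ≤ A := by
    obtain ⟨A₀, hA₀⟩ := (hTfin.image fun r => ∑ i, ∑ j, |X.ι r i j|).bddAbove
    refine ⟨max A₀ 1, le_max_right _ _, fun r hr i j => ?_⟩
    have h1 : ∑ i, ∑ j, |X.ι r i j| ≤ A₀ := hA₀ ⟨r, hr, rfl⟩
    have h2 : |X.ι r i j| ≤ ∑ i, ∑ j, |X.ι r i j| := by
      have h3 : |X.ι r i j| ≤ ∑ j, |X.ι r i j| :=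
        Finset.single_le_sum (f := fun j => |X.ι r i j|) (fun _ _ => abs_nonneg _) (Finset.mem_univ j)
      exact h3.trans (Finset.single_le_sum (f := fun i => ∑ j, |X.ι r i j|)
        (fun _ _ => Finset.sum_nonneg fun _ _ => abs_nonneg _) (Finset.mem_univ i))
    exact (h2.trans h1).trans (le_max_left _ _)
  refine ⟨2 * (2 * A * R) ^ 2, fun z => ?_⟩
  -- `z = h • i`
  let h : GL (Fin 2) ℝ := (UpperHalfPlane.toSL2R z : GL (Fin 2) ℝ)
  have hz : h • UpperHalfPlane.I = z := UpperHalfPlane.toSL2R_smul_I z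
  have hhdet : ∀ s : SL(2, ℝ), ((s : GL (Fin 2) ℝ) : Matrix (Fin 2) (Fin 2) ℝ).det = 1 := fun s => by
    simp
  -- the short vector of `h⁻¹ ι(O)`
  have hgdet : (((UpperHalfPlane.toSL2R z)⁻¹ : SL(2, ℝ)) : GL (Fin 2) ℝ) = h⁻¹ := map_inv _ _
  obtain ⟨x, hxO, hx0, hxR⟩ := hR ((h⁻¹ : GL (Fin 2) ℝ) : Matrix (Fin 2) (Fin 2) ℝ)
    (by rw [← hgdet]; exact hhdet _)
  set k : Matrix (Fin 2) (Fin 2) ℝ := ((h⁻¹ : GL (Fin 2) ℝ) : Matrix (Fin 2) (Fin 2) ℝ) * X.ι x with hk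
  -- `det k = nrd x`, a non-zero integer of absolute value `≤ 2R²`
  have hnrd0 : nrdZ x ≠ 0 := by
    intro h0
    have h1 : reducedNorm ℚ X.B x = 0 := by rw [← hZ.cast_nrdZ hxO, h0, Int.cast_zero]
    exact ((isUnit_iff_reducedNorm_ne_zero_holds ℚ X.B x).mp (X.isUnit_of_one_lt hD hx0)) h1
  have hkdet : k.det = (nrdZ x : ℝ) := by
    rw [hk, Matrix.det_mul, ← hgdet, hhdet, one_mul, (X.trace_ι_eq_and_det_ι_eq x).2,
      ← hZ.cast_nrdZ hxO, Rat.cast_intCast]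
  have hkdet1 : 1 ≤ |k.det| := by
    rw [hkdet, ← Int.cast_abs]
    exact_mod_cast Int.one_le_abs hnrd0
  have hNB : (nrdZ x).natAbs ≤ ⌊2 * R ^ 2⌋₊ := by
    apply Nat.le_floor
    have := abs_det_le_of_abs_le hxR
    rw [hkdet, ← Int.cast_abs] at this
    rw [Nat.cast_natAbs]
    exact this
  -- `x = u r`
  obtain ⟨r, hrT, u, hu, u', hu', huu', hu'u, hNu, hxur⟩ := hT x hxO hx0 hNB
  have hNu' : nrdZ u' = 1 := by
    have := hZ.nrdZ_mul hu hu'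
    rw [huu', IsZOrder.nrdZ_one, hNu, one_mul] at this
    exact this.symm
  -- the element `γ = ι(u') = ι(u)⁻¹ ∈ Γ`
  let γ : GL (Fin 2) ℝ :=
    ⟨X.ι u', X.ι u, by rw [← map_mul, hu'u, map_one], by rw [← map_mul, huu', map_one]⟩
  have hγdet : (γ : Matrix (Fin 2) (Fin 2) ℝ).det = 1 := by
    change (X.ι u').det = 1
    rw [(X.trace_ι_eq_and_det_ι_eq u').2, ← hZ.cast_nrdZ hu', hNu']
    simp
  have hγ : γ ∈ X.Gamma := by
    refine ⟨⟨u', hu', rfl⟩, ⟨u, hu, rfl⟩, ?_⟩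
    ext
    rw [Matrix.GeneralLinearGroup.val_det_apply, hγdet, Units.val_one]
  refine ⟨γ, hγ, ?_⟩
  -- `γ h = ι(r) k⁻¹`
  have hku : IsUnit k.det := by
    rw [isUnit_iff_ne_zero]
    intro h0
    rw [h0, abs_zero] at hkdet1
    exact absurd hkdet1 (by norm_num)
  have hγh : ((γ * h : GL (Fin 2) ℝ) : Matrix (Fin 2) (Fin 2) ℝ) = X.ι r * k⁻¹ := by
    have h1 : X.ι u * X.ι r = (h : Matrix (Fin 2) (Fin 2) ℝ) * k := by
      rw [← map_mul, ← hxur, hk, ← mul_assoc, Units.mul_inv, one_mul]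
    have h2 : X.ι r = X.ι u' * (h : Matrix (Fin 2) (Fin 2) ℝ) * k := by
      rw [mul_assoc, ← h1, ← mul_assoc, ← map_mul, hu'u, map_one, one_mul]
    rw [Units.val_mul, h2, mul_assoc, Matrix.mul_nonsing_inv _ hku, mul_one]
  -- entries of `γ h` are bounded by `2 A R`
  have hkinv : ∀ i j, |k⁻¹ i j| ≤ R := abs_inv_apply_le hxR hkdet1
  have hentries : ∀ i j, |((γ * h : GL (Fin 2) ℝ) : Matrix (Fin 2) (Fin 2) ℝ) i j| ≤ 2 * A * R := by
    intro i j
    rw [hγh]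
    -- entries of a product of `2 × 2` matrices with entries bounded by `A` and `R`
    -- (cf. the tree's `Fuchsian.abs_mul_apply_le`, `FuchsianGroupCusps.lean`)
    have hA0 : 0 ≤ A := (abs_nonneg _).trans (hA r hrT 0 0)
    rw [Matrix.mul_apply, Fin.sum_univ_two]
    have h0 : |X.ι r i 0 * k⁻¹ 0 j| ≤ A * R := by
      rw [abs_mul]; exact mul_le_mul (hA r hrT i 0) (hkinv 0 j) (abs_nonneg _) hA0
    have h1 : |X.ι r i 1 * k⁻¹ 1 j| ≤ A * R := by
      rw [abs_mul]; exact mul_le_mul (hA r hrT i 1) (hkinv 1 j) (abs_nonneg _) hA0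
    calc |X.ι r i 0 * k⁻¹ 0 j + X.ι r i 1 * k⁻¹ 1 j|
        ≤ |X.ι r i 0 * k⁻¹ 0 j| + |X.ι r i 1 * k⁻¹ 1 j| := abs_add_le _ _
      _ ≤ 2 * A * R := by linarith
  -- hence `cosh d(i, γ z) ≤ 2 (2AR)²` and `d ≤ cosh d`
  rw [Metric.mem_closedBall, dist_comm, ← hz, ← mul_smul]
  have hdet1 : ((γ * h : GL (Fin 2) ℝ) : Matrix (Fin 2) (Fin 2) ℝ).det = 1 := by
    rw [Units.val_mul, Matrix.det_mul, hγdet, one_mul]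
    exact hhdet _
  have hcosh := cosh_dist_I_smul (γ * h) hdet1
  have hsq : ∀ i j, (((γ * h : GL (Fin 2) ℝ) : Matrix (Fin 2) (Fin 2) ℝ) i j) ^ 2 ≤ (2 * A * R) ^ 2 :=
    fun i j => by
      rw [← sq_abs]
      exact pow_le_pow_left₀ (abs_nonneg _) (hentries i j) 2
  have hle : Real.cosh (dist UpperHalfPlane.I ((γ * h) • UpperHalfPlane.I)) ≤ 2 * (2 * A * R) ^ 2 := by
    rw [hcosh]
    have := hsq 0 0; have := hsq 0 1; have := hsq 1 0; have := hsq 1 1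
    linarith
  refine le_trans ?_ hle
  -- `t ≤ cosh t`
  have ht := dist_nonneg (x := UpperHalfPlane.I) (y := (γ * h) • UpperHalfPlane.I)
  nlinarith [Real.cosh_sq' (dist UpperHalfPlane.I ((γ * h) • UpperHalfPlane.I)),
    Real.self_le_sinh_iff.mpr ht, Real.cosh_pos (dist UpperHalfPlane.I ((γ * h) • UpperHalfPlane.I))]

/-- **`vol(X₀^D(M)) < ∞`** for `D > 1`: the datum's fundamental domain has finite hyperbolic
area. Unfolding the indicator of the compact ball `K = B̄(i, ρ)` of
`exists_forall_exists_smul_mem_closedBall` over `X.fd` (tree `setLIntegral_tsum_smul_eq`: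
`∫_F Σ_γ 𝟙_K(γ w) dμ = 2 vol K`) and `Σ_γ 𝟙_K(γ w) ≥ 1` give `vol(X.fd) ≤ 2 vol(K) < ∞`.
[cite: VignerasLNM800, Ch. IV §1 Thm. 1.1] -/
theorem volume_fd_lt_top (hD : 1 < D) : volume X.fd < ⊤ := by
  obtain ⟨ρ, hρ⟩ := X.exists_forall_exists_smul_mem_closedBall hD
  set K : Set ℍ := Metric.closedBall UpperHalfPlane.I ρ with hK
  have hKc : IsCompact K := isCompact_closedBall _ _
  have hKm : MeasurableSet K := Metric.isClosed_closedBall.measurableSet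
  have hKvol : volume K < ⊤ := hKc.measure_lt_top
  haveI : Countable X.Gamma := X.countable_Gamma.to_subtype
  have hunf := setLIntegral_tsum_smul_eq X.Gamma_le_range_toGL X.neg_one_mem_Gamma X.countable_Gamma
    X.isHypFundamentalDomain_fd (φ := K.indicator fun _ => (1 : ℝ≥0∞))
    ((measurable_const.indicator hKm).aemeasurable)
  rw [lintegral_indicator hKm, setLIntegral_const, one_mul] at hunf
  have hle : volume X.fd ≤ ∫⁻ w in X.fd, ∑' γ : X.Gamma, K.indicator (fun _ => (1 : ℝ≥0∞))
      ((γ : GL (Fin 2) ℝ) • w) := by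
    rw [← setLIntegral_one]
    refine setLIntegral_mono' X.isHypFundamentalDomain_fd.measurableSet fun w _ => ?_
    obtain ⟨γ, hγ, hγw⟩ := hρ w
    refine le_trans ?_ (ENNReal.le_tsum (⟨γ, hγ⟩ : X.Gamma))
    rw [Set.indicator_of_mem hγw]
  calc volume X.fd ≤ _ := hle
    _ = 2 * volume K := hunf
    _ < ⊤ := ENNReal.mul_lt_top (by simp) hKvol

end ShimuraCurveData

end Literature.NumberTheory.Automorphic

end
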